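import Summits.BirchSwinnertonDyer.BirchSwinnertonDyer.Theorems.SignedLowerHalvesSmallImageLowerHalfBothSignsRttD2SeqJ3LayerPairing
import Mathlib.Order.KonigLemma
import HarnessLib

/-!
# Route `SignedLowerHalves`, crux L `SmallImageLowerHalfBothSigns` (stmt-BirchSwinnertonDyer-23599), line `rtt_w3` v14 → v15 — E2, row J3
# (Galois side, part α″): THE POITOU–TATE ANNIHILATOR IDENTITY `hPT` FROM ITS LAYERWISE FORM, BY KŐNIG'S LEMMA OVER THE FINITE LAYER GROUPS

WIDTH seat `bsd-line-slh-p3-w3` g22 under LEAD `cruxlead-stmt-BirchSwinnertonDyer-23599` g11 (cell `bsd-ssimc`; KEY 2026-08-30T18:56:57Z, RULING (F1)/(F2) 19:25:38Z);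
helper `--supports stmt-BirchSwinnertonDyer-23599`. DEFINITIONS WITH BODIES (`boxTrunc`, `boxFamilies`) + THEOREMS; no named fact, no instance, no `sorry`. HONEST FRAMING:
bookkeeping — the layerwise Poitou–Tate solutions are a HYPOTHESIS (`hsol`); E2, crux L, crux M and BSD remain OPEN and are proved for NO curve.

WHAT. `hPT` of `exists_junction_exact` (p782881) asks: every character `q` of `E^{ε}_{sat,v}` killing `loc_v(Sel)` is `P b` for some `b` of the junction carrier. With
`P = (𝓛.towerPairing I).pairing` (parts α/α′) and `B = I.H = lim←_{n,k} G_{n,k}` (honda's pin (P4) `proj_surjective`), this is a COMPACTNESS statement: Poitou–Tate at the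
finite layer `(n, k)` provides solutions `y_{n,k} ∈ G_{n,k}` of `⟨y, ℓ⟩ = q(res_n toH1 ℓ)` inside the strict sets `Str n k` (`(F1)`); the solution sets are FINITE and map to
each other under `coresLE`/`redLE`; Kőnig's lemma (Mathlib's `exists_seq_forall_proj_of_forall_finite`, run on TRUNCATED BOX FAMILIES `(Y_{n,k})_{n,k ≤ m}` — no index
arithmetic) yields a compatible family, hence `b`.
* §1 `boxTrunc`, `boxFamilies` (families on `[0,m]²` lying in prescribed sets `A n k`, `coresLE`/`redLE`-compatible, zero off the box) and their calculus
  (`boxFamilies_boxTrunc`, `boxTrunc_boxTrunc`, `boxTrunc_eq_self`, finiteness, non-emptiness from ONE element of `A m m` by descent).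
* §2 ★★ `exists_proj_mem_of_forall_nonempty`: for transition-closed sets `A n k ⊆ G_{n,k}` with `A m m ≠ ∅` for all `m` and finite `G_{n,k}`, some `b ∈ B` has ALL
  `proj_{n,k} b ∈ A n k`.
* §3 ★★★ `exists_proj_mem_and_pairing_eq` = `hPT` ON THE STRICT CARRIER: from diagonal layerwise solutions (`hsol`) in `Str m m`, a `b` with `proj_{n,k} b ∈ Str n k` for all
  `(n, k)` and `(𝓛.towerPairing I).pairing b = q` on `E^{ε}_{sat,v}` (`Good n k ⊆ L_{n,k}`: any transition-stable family of finite-level classes exhausting `E^{ε}_{sat,v}`,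
  e.g. the preimage of `E^{ε}_{sat,v}`).
References: [Rubin2000] Thm. 1.7.3, Prop. B.1.1 (compactness in passing to the limit); [Kobayashi2003] Thm. 7.3 i); [MilneADT2006] I Thm. 4.10; [NeukirchSchmidtWingberg2008]
I §5, (1.5.1); D. Kőnig, *Theorie der endlichen und unendlichen Graphen* (1936) §6 (via Mathlib `Order.KonigLemma`).
-/

set_option autoImplicit false
set_option linter.dupNamespace false -- D-0017: single-problem summit, the namespace repeats the problem name by design
noncomputable section

open scoped Classical
open NumberField IsDedekindDomain Field

namespace Summit.BirchSwinnertonDyer.BirchSwinnertonDyer.Theorems.SmallImageRttD2Seq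

open Literature.NumberTheory.EllipticCurves Literature.NumberTheory.EllipticCurves.Kobayashi2003
  Literature.NumberTheory.EllipticCurves.GreenbergVatsal2000 Literature.NumberTheory.GaloisRepresentations
  Summit.BirchSwinnertonDyer.BirchSwinnertonDyer.Theorems.SmallImageCharSignedSelmer
  Summit.BirchSwinnertonDyer.BirchSwinnertonDyer.Theorems.SmallImageRttD2J1

namespace LayerPairing

variable {K : Type} [Field K] [NumberField K] {p : ℕ} [Fact p.Prime] {κ : ZpExtension K p} {S : Set (PadicAlgCl p)}
  {M : Type} [AddCommGroup M] [TopologicalSpace M] [DiscreteTopology M] [Module (padicCoeffIntegers S) M]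
  {v : HeightOneSpectrum (𝓞 K)} [DistribMulAction (absoluteGaloisGroup (v.adicCompletion K)) M]
  [SMulCommClass (absoluteGaloisGroup (v.adicCompletion K)) (padicCoeffIntegers S) M]
  {γv : absoluteGaloisGroup (v.adicCompletion K)}
  {γB : absoluteGaloisGroup K} {θ' : absoluteGaloisGroup K →ₜ* (padicCoeffIntegers S)ˣ} {P : Set (HeightOneSpectrum (𝓞 K))}
  (𝓛 : LayerPairing S M γv κ γB θ' P) {I : CycIwasawaCohomologyDataO S κ γB θ' P 1}

/-! ## §1. Truncated box families -/

section Box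

variable (A : ∀ n k : ℕ, Set (cycLayerCohO S κ θ' P n k 1))

/-- Truncation of a family `(Y_{n,k})` to the box `[0,m]²` (zero outside). [cite: NeukirchSchmidtWingberg2008, I §5 (1.5.1)] -/
def boxTrunc (m : ℕ) (Y : ∀ n k : ℕ, cycLayerCohO S κ θ' P n k 1) : ∀ n k : ℕ, cycLayerCohO S κ θ' P n k 1 :=
  fun n k ↦ if n ≤ m ∧ k ≤ m then Y n k else 0

/-- **Box families of level `m`**: families `(Y_{n,k})` lying in the prescribed sets `A n k` on the box `[0,m]²`, compatible there under the transition maps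
`coresLE`/`redLE` of the socket, and zero off the box. [cite: NeukirchSchmidtWingberg2008, I §5 (1.5.1)] [cite: Rubin2000, Prop. B.1.1] -/
def boxFamilies (m : ℕ) : Set (∀ n k : ℕ, cycLayerCohO S κ θ' P n k 1) :=
  {Y | (∀ n k : ℕ, n ≤ m → k ≤ m → Y n k ∈ A n k) ∧
    (∀ {n n' : ℕ} (hn : n ≤ n') {k k' : ℕ} (hk : k ≤ k'), n' ≤ m → k' ≤ m → Y n k = 𝓛.coresLE hn k (𝓛.redLE n' hk (Y n' k'))) ∧
      ∀ n k : ℕ, ¬ (n ≤ m ∧ k ≤ m) → Y n k = 0}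

variable {𝓛 A}

omit [NumberField K] [TopologicalSpace M] [DiscreteTopology M] [SMulCommClass (absoluteGaloisGroup (v.adicCompletion K)) (padicCoeffIntegers S) M] in
/-- Values of the truncation inside the box. [folklore] -/
theorem boxTrunc_of_le {m n k : ℕ} (Y : ∀ n k : ℕ, cycLayerCohO S κ θ' P n k 1) (hn : n ≤ m) (hk : k ≤ m) : boxTrunc m Y n k = Y n k :=
  if_pos ⟨hn, hk⟩

/-- Truncating a box family of level `m′ ≥ m` to level `m` gives a box family of level `m`. [cite: NeukirchSchmidtWingberg2008, I §5 (1.5.1)] -/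
theorem boxFamilies_boxTrunc {m m' : ℕ} (h : m ≤ m') {Y : ∀ n k : ℕ, cycLayerCohO S κ θ' P n k 1} (hY : Y ∈ 𝓛.boxFamilies A m') :
    boxTrunc m Y ∈ 𝓛.boxFamilies A m := by
  refine ⟨fun n k hn hk ↦ ?_, fun {n n'} hn {k k'} hk hn' hk' ↦ ?_, fun n k hnk ↦ if_neg hnk⟩
  · rw [boxTrunc_of_le Y hn hk]; exact hY.1 n k (hn.trans h) (hk.trans h)
  · rw [boxTrunc_of_le Y (hn.trans hn') (hk.trans hk'), boxTrunc_of_le Y hn' hk']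
    exact hY.2.1 hn hk (hn'.trans h) (hk'.trans h)

omit [NumberField K] [TopologicalSpace M] [DiscreteTopology M] [SMulCommClass (absoluteGaloisGroup (v.adicCompletion K)) (padicCoeffIntegers S) M] in
/-- Truncation is transitive. [folklore] -/
theorem boxTrunc_boxTrunc {m m' : ℕ} (h : m ≤ m') (Y : ∀ n k : ℕ, cycLayerCohO S κ θ' P n k 1) : boxTrunc m (boxTrunc m' Y) = boxTrunc m Y := by
  funext n k
  by_cases hnk : n ≤ m ∧ k ≤ m
  · rw [boxTrunc_of_le _ hnk.1 hnk.2, boxTrunc_of_le _ hnk.1 hnk.2, boxTrunc_of_le _ (hnk.1.trans h) (hnk.2.trans h)]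
  · simp only [boxTrunc, if_neg hnk]

/-- A box family of level `m` is its own truncation. [folklore] -/
theorem boxTrunc_eq_self {m : ℕ} {Y : ∀ n k : ℕ, cycLayerCohO S κ θ' P n k 1} (hY : Y ∈ 𝓛.boxFamilies A m) : boxTrunc m Y = Y := by
  funext n k
  by_cases hnk : n ≤ m ∧ k ≤ m
  · rw [boxTrunc_of_le _ hnk.1 hnk.2]
  · simp only [boxTrunc, if_neg hnk, hY.2.2 n k hnk]

/-- **Box families of a fixed level form a FINITE set** when the layer groups are finite (a box family is determined by its finitely many box values).
[cite: MilneADT2006, I Thm. 4.10] -/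
theorem finite_boxFamily (hfin : ∀ n k : ℕ, Finite (cycLayerCohO S κ θ' P n k 1)) (m : ℕ) : Finite {Y // Y ∈ 𝓛.boxFamilies A m} := by
  haveI : ∀ n k : ℕ, Finite (cycLayerCohO S κ θ' P n k 1) := hfin
  refine Finite.of_injective (fun Y : {Y // Y ∈ 𝓛.boxFamilies A m} ↦ fun (i : Fin (m + 1)) (j : Fin (m + 1)) ↦ Y.1 i j) fun Y Y' hYY' ↦ ?_
  refine Subtype.ext (funext fun n ↦ funext fun k ↦ ?_)
  by_cases hnk : n ≤ m ∧ k ≤ m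
  · have h := congrFun (congrFun hYY' ⟨n, Nat.lt_succ_of_le hnk.1⟩) ⟨k, Nat.lt_succ_of_le hnk.2⟩
    exact h
  · rw [Y.2.2.2 n k hnk, Y'.2.2.2 n k hnk]

/-- **Descent: ONE element of `A m m` spreads to a box family of level `m`** when the sets `A` are closed under the transitions (`y_{n,k} := coresLE (redLE y)`; compatibility by
functoriality and the commutation `coresLE ∘ redLE = redLE ∘ coresLE`). [cite: NeukirchSchmidtWingberg2008, I §5 (1.5.1)] -/
theorem boxFamilies_nonempty_of_mem (hA : ∀ {n n' : ℕ} (hn : n ≤ n') {k k' : ℕ} (hk : k ≤ k') (y : cycLayerCohO S κ θ' P n' k' 1),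
      y ∈ A n' k' → 𝓛.coresLE hn k (𝓛.redLE n' hk y) ∈ A n k)
    (m : ℕ) {y : cycLayerCohO S κ θ' P m m 1} (hy : y ∈ A m m) : ∃ Y, Y ∈ 𝓛.boxFamilies A m := by
  refine ⟨fun n k ↦ if h : n ≤ m ∧ k ≤ m then 𝓛.coresLE h.1 k (𝓛.redLE m h.2 y) else 0, fun n k hn hk ↦ ?_, fun {n n'} hn {k k'} hk hn' hk' ↦ ?_,
    fun n k hnk ↦ dif_neg hnk⟩
  · dsimp only
    rw [dif_pos ⟨hn, hk⟩]; exact hA hn hk y hy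
  · dsimp only
    rw [dif_pos ⟨hn.trans hn', hk.trans hk'⟩, dif_pos ⟨hn', hk'⟩, ← 𝓛.coresLE_redLE hn' hk, 𝓛.coresLE_trans, 𝓛.redLE_trans]

end Box

/-! ## §2. Kőnig: a global element with all projections in prescribed finite sets -/

/-- ★★ **From diagonal non-emptiness to a global element.** Let `A n k ⊆ G_{n,k}` be closed under the transitions (`coresLE hn (redLE hk (A n′ k′)) ⊆ A n k`), with every
layer group finite and every diagonal set `A m m` non-empty. Then some `b ∈ B = I.H` has `proj_{n,k} b ∈ A n k` for ALL `(n, k)`: Kőnig's lemma on the finite non-empty sets of box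
families under truncation gives a compatible sequence of box families, whose diagonal glues to a `cycLayerCoresO`/`cycLayerRedO`-compatible family, i.e. (pin (P4)) an element
of `B`. [cite: Rubin2000, Prop. B.1.1] [cite: MilneADT2006, I Thm. 4.10] [cite: NeukirchSchmidtWingberg2008, I §5 (1.5.1)] -/
theorem exists_proj_mem_of_forall_nonempty (hfin : ∀ n k : ℕ, Finite (cycLayerCohO S κ θ' P n k 1)) (A : ∀ n k : ℕ, Set (cycLayerCohO S κ θ' P n k 1))
    (hA : ∀ {n n' : ℕ} (hn : n ≤ n') {k k' : ℕ} (hk : k ≤ k') (y : cycLayerCohO S κ θ' P n' k' 1), y ∈ A n' k' → 𝓛.coresLE hn k (𝓛.redLE n' hk y) ∈ A n k)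
    (hne : ∀ m : ℕ, (A m m).Nonempty) : ∃ b : I.H, ∀ n k : ℕ, I.proj n k b ∈ A n k := by
  -- Kőnig on the inverse system of box families under truncation
  haveI : ∀ m : ℕ, Finite {Y // Y ∈ 𝓛.boxFamilies A m} := finite_boxFamily hfin
  haveI : ∀ m : ℕ, Nonempty {Y // Y ∈ 𝓛.boxFamilies A m} := fun m ↦ by
    obtain ⟨y, hy⟩ := hne m
    obtain ⟨Y, hY⟩ := boxFamilies_nonempty_of_mem hA m hy
    exact ⟨⟨Y, hY⟩⟩
  obtain ⟨s, hs⟩ := exists_seq_forall_proj_of_forall_finite (α := fun m ↦ {Y // Y ∈ 𝓛.boxFamilies A m})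
    (fun {i j} hij Y ↦ ⟨boxTrunc i Y.1, boxFamilies_boxTrunc hij Y.2⟩) (fun i Y ↦ Subtype.ext (boxTrunc_eq_self Y.2))
    (fun i j k hij hjk Y ↦ Subtype.ext (boxTrunc_boxTrunc hij Y.1)) (fun i Y ↦ Set.toFinite _)
  -- the glued family along the diagonal
  have hval : ∀ {m m' : ℕ} (h : m ≤ m') (n k : ℕ), n ≤ m → k ≤ m → (s m).1 n k = (s m').1 n k := fun {m m'} h n k hn hk ↦ by
    have h1 := congrArg Subtype.val (hs h)
    change boxTrunc m (s m').1 = (s m).1 at h1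
    rw [← h1, boxTrunc_of_le _ hn hk]
  let y : ∀ n k : ℕ, cycLayerCohO S κ θ' P n k 1 := fun n k ↦ (s (max n k)).1 n k
  have hcores : ∀ n k, cycLayerCoresO S κ θ' P n k 1 (y (n + 1) k) = y n k := fun n k ↦ by
    change cycLayerCoresO S κ θ' P n k 1 ((s (max (n + 1) k)).1 (n + 1) k) = (s (max n k)).1 n k
    rw [hval (max_le_max (Nat.le_succ n) le_rfl) n k (le_max_left n k) (le_max_right n k),
      (s (max (n + 1) k)).2.2.1 (Nat.le_succ n) (le_refl k) (le_max_left _ _) (le_max_right _ _), 𝓛.redLE_refl, 𝓛.coresLE_succ]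
  have hred : ∀ n k, cycLayerRedO S κ θ' P n k 1 (y n (k + 1)) = y n k := fun n k ↦ by
    change cycLayerRedO S κ θ' P n k 1 ((s (max n (k + 1))).1 n (k + 1)) = (s (max n k)).1 n k
    rw [hval (max_le_max le_rfl (Nat.le_succ k)) n k (le_max_left n k) (le_max_right n k),
      (s (max n (k + 1))).2.2.1 (le_refl n) (Nat.le_succ k) (le_max_left _ _) (le_max_right _ _), 𝓛.coresLE_refl, 𝓛.redLE_succ]
  obtain ⟨b, hb⟩ := I.proj_surjective y hcores hred
  refine ⟨b, fun n k ↦ ?_⟩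
  rw [hb]
  exact (s (max n k)).2.1 n k (le_max_left n k) (le_max_right n k)

/-! ## §3. `hPT` on the strict carrier -/

/-- ★★★ **The Poitou–Tate annihilator identity `hPT` ON THE STRICT CARRIER, from layerwise solutions.** Data: the finite-level socket `𝓛`, transition-closed «strict» subsets
`Str n k ⊆ G_{n,k}` ((F1): intended `ker loc_{S₀K}`), transition-stable «good» subsets `Good n k ⊆ L_{n,k}` whose images exhaust `E^{ε}_{sat,v}` (e.g. the preimage of
`E^{ε}_{sat,v}`), finite layer groups. HYPOTHESIS `hsol` (Poitou–Tate at the diagonal layers `(m, m)`, [Rubin, Thm. 1.7.3] applied to `q ∘ res_m ∘ toH1`): a strict `y ∈ Str m m`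
with `⟨y, ℓ⟩ = q(res_m toH1 ℓ)` for all good `ℓ`. CONCLUSION: a `b ∈ B` with every `proj_{n,k} b` strict and `(𝓛.towerPairing I).pairing b = q` — the binder `hPT` of
`exists_junction_exact` (p782881) for the junction carrier `B' = {b | ∀ n k, proj_{n,k} b ∈ Str n k}` of RULING (F1). [cite: Rubin2000, Thm. 1.7.3, Prop. B.1.1]
[cite: Kobayashi2003, Thm. 7.3 i)] [cite: MilneADT2006, I Thm. 4.10] -/
theorem exists_proj_mem_and_pairing_eq {V : WeierstrassCurve K} {j : V.geomPrimaryTorsion p →+ M} {ε : ℤˣ}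
    (hstab : ∀ m : M, IsOpen (MulAction.stabilizer (absoluteGaloisGroup (v.adicCompletion K)) m : Set (absoluteGaloisGroup (v.adicCompletion K))))
    (hfin : ∀ n k : ℕ, Finite (cycLayerCohO S κ θ' P n k 1))
    (Str : ∀ n k : ℕ, Set (cycLayerCohO S κ θ' P n k 1))
    (hStr : ∀ {n n' : ℕ} (hn : n ≤ n') {k k' : ℕ} (hk : k ≤ k') (y : cycLayerCohO S κ θ' P n' k' 1), y ∈ Str n' k' → 𝓛.coresLE hn k (𝓛.redLE n' hk y) ∈ Str n k)
    (Good : ∀ n k : ℕ, Set (𝓛.L n k))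
    (hgoodE : ∀ (n k : ℕ) (ℓ : 𝓛.L n k), ℓ ∈ Good n k →
      resOfLe M (localSubgroupOfEmb_kerSubgroup_le κ v n) (𝓛.toH1 n k ℓ) ∈ localCondInftySat κ M (padicCoeffIntegers S) V j ε v)
    (hgood : ∀ c : localCondInftySat κ M (padicCoeffIntegers S) V j ε v, ∃ (n k : ℕ) (ℓ : 𝓛.L n k), ℓ ∈ Good n k ∧
      resOfLe M (localSubgroupOfEmb_kerSubgroup_le κ v n) (𝓛.toH1 n k ℓ) = c)
    (hgood_mono : ∀ {n n' : ℕ} (hn : n ≤ n') {k k' : ℕ} (hk : k ≤ k') (ℓ : 𝓛.L n k), ℓ ∈ Good n k → 𝓛.inclLE n' hk (𝓛.resLE hn k ℓ) ∈ Good n' k')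
    (q : localCondInftySat κ M (padicCoeffIntegers S) V j ε v →+ AddCircle (1 : ℚ))
    (hsol : ∀ m : ℕ, ∃ y ∈ Str m m, ∀ (ℓ : 𝓛.L m m) (hℓ : ℓ ∈ Good m m), 𝓛.pairNK m m y ℓ = q ⟨_, hgoodE m m ℓ hℓ⟩) :
    ∃ b : I.H, (∀ n k : ℕ, I.proj n k b ∈ Str n k) ∧ ∀ c : localCondInftySat κ M (padicCoeffIntegers S) V j ε v, (𝓛.towerPairing I).pairing hstab b c = q c := by
  -- the transition-closed family of «strict solutions»
  let A : ∀ n k : ℕ, Set (cycLayerCohO S κ θ' P n k 1) := fun n k ↦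
    {y | y ∈ Str n k ∧ ∀ (ℓ : 𝓛.L n k) (hℓ : ℓ ∈ Good n k), 𝓛.pairNK n k y ℓ = q ⟨_, hgoodE n k ℓ hℓ⟩}
  have hval : ∀ {n n' : ℕ} (hn : n ≤ n') {k k' : ℕ} (hk : k ≤ k') (ℓ : 𝓛.L n k),
      resOfLe M (localSubgroupOfEmb_kerSubgroup_le κ v n') (𝓛.toH1 n' k' (𝓛.inclLE n' hk (𝓛.resLE hn k ℓ))) =
        resOfLe M (localSubgroupOfEmb_kerSubgroup_le κ v n) (𝓛.toH1 n k ℓ) := fun {n n'} hn {k k'} hk ℓ ↦ by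
    have h1 := DFunLike.congr_fun (resOfLe_comp_holds (M := M) (localSubgroupOfEmb_kerSubgroup_le κ v n') (localSubgroupOfEmb_layerSubgroup_antitone κ v hn))
      (𝓛.toH1 n k ℓ)
    rw [AddMonoidHom.comp_apply] at h1
    rw [𝓛.toH1_inclLE, 𝓛.toH1_resLE, h1]
  have hA : ∀ {n n' : ℕ} (hn : n ≤ n') {k k' : ℕ} (hk : k ≤ k') (y : cycLayerCohO S κ θ' P n' k' 1), y ∈ A n' k' → 𝓛.coresLE hn k (𝓛.redLE n' hk y) ∈ A n k :=
    fun {n n'} hn {k k'} hk y hy ↦ ⟨hStr hn hk y hy.1, fun ℓ hℓ ↦ by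
      rw [𝓛.pairNK_coresLE, 𝓛.pairNK_redLE, hy.2 _ (hgood_mono hn hk ℓ hℓ)]
      exact congrArg q (Subtype.ext (hval hn hk ℓ))⟩
  obtain ⟨b, hb⟩ := 𝓛.exists_proj_mem_of_forall_nonempty (I := I) hfin A hA fun m ↦ by
    obtain ⟨y, hy, hyq⟩ := hsol m
    exact ⟨y, hy, hyq⟩
  refine ⟨b, fun n k ↦ (hb n k).1, fun c ↦ ?_⟩
  obtain ⟨n, k, ℓ, hℓ, hc⟩ := hgood c
  have hc' : c = ⟨_, hgoodE n k ℓ hℓ⟩ := Subtype.ext hc.symm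
  rw [hc', towerPairing_pairing_apply]
  exact (hb n k).2 ℓ hℓ

end LayerPairing

end Summit.BirchSwinnertonDyer.BirchSwinnertonDyer.Theorems.SmallImageRttD2Seq

end
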